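import Summits.MatrixMultiplication.MatrixMultiplication.Theorems.FarEdgeDescentExpFloor
import HarnessLib

/-!
# Route `FarEdgeDescent` — the DEFECT DIAL of the generic leaf: bounded doubling defect
`∃ C, e(m)² ≤ C·(ω−2)·e(2m−1)` (aside `BoundedDoublingDefect`, stmt-MatrixMultiplication-26556, route rev 10)
still prices to an exponential floor and still decides the summit with either special leaf
(`FiniteSaturation`, stmt-23739, or `SuperExpContact`, stmt-28901); it sits STRICTLY between the law of
record `AnchoredLogConvexity` (stmt-28900) and the bare residual — all PROVED

decomp-mm ROOT cell (D-0178), lens 2 «structural dichotomy: special vs generic», gen 18.  Notation as in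
`FarEdgeDescentExpFloor`: `e(x) := ω(1,x,1) − (x+1) ≥ 0` (excess on the real shape axis `⟨n,n^x,n⟩`),
`w := e(1) = ω − 2`, `s := 3 − ω`.  The node of record is `ω = 2 ⟺ FiniteSaturation ∧ AnchoredLogConvexity`
(`FarEdgeDescentChord.node_iff`); gen 17 priced the generic law (`expFloor_of_alc`) and banked the deeper
cut `ω = 2 ⟺ SuperExpContact ∧ AnchoredLogConvexity` (`node_expCut_iff`).  This file turns the GENERIC leaf
into a dial.  Write `BDD_C` for the law with DEFECT `C`: `∀ m > 1, e(m)² ≤ C·w·e(2m−1)` (`C = 1` is the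
anchored law; `BDD := ∃ C, BDD_C` = "bounded doubling defect": along the doubling `m ↦ 2m−1` of the shape
exponent the excess may lose at most a bounded factor against log-convexity through the square).

* §0–§1 **EXPONENTIAL FLOOR UNDER BOUNDED DEFECT (PROVED).** `BDD_C ∧ ω > 2 ⟹
  e(K) ≥ (w/4C)·exp(−4·log(2C)·(s/w)·(K−1))` for every real `K > 1` and every `C ≥ 1`
  (`exp_floor_defect`, `expFloor_of_bdd`); hence `BDD ∧ ω > 2 ⟹ ∃ ρ > 0, e(k) ≥ ρ^k ∀ k ≥ 1`
  (`geometric_floor_of_bdd`).  Mechanism: gen 17's orbit floor with anchor value `C·w`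
  (`orbit_floor`, re-used, not restated) stopped at the depth `j` with `2a ≤ 2^j ≤ 4a+2`, `a = (s/w)(K−1)`,
  where the anchor line (`anchorLine_le_excess`) still gives `e(m_j) ≥ w/2`; the defect costs the factor
  `(2C)^{−2^j}`, exponential in `K` — the rate degrades from `s/w` (gen 17, `C = 1`) to `4·log(2C)·s/w`, the
  SHAPE of the floor does not.
* §2 **TWO EXACT CUTS WITH THE WEAKER GENERIC LEAF (PROVED both ways).**
  `SuperExpContact → BDD → ω = 2` (`closes_bddSec`) and `FiniteSaturation → BDD → ω = 2` (`closes_bddFs`);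
  `ω = 2 ⟺ SuperExpContact ∧ BDD` (`node_bddSec_iff`), `ω = 2 ⟺ FiniteSaturation ∧ BDD` (`node_bddFs_iff`).
* §3 **THE DIAL (PROVED).** `RealLogConvexity ⟹ AnchoredLogConvexity ⟹ BDD ⟹ (SuperExpContact → ω = 2)`
  (`dial_chain`), and the last notch IS the bare residual of the special leaf: `(SuperExpContact → ω = 2) ⟺
  (ω > 2 → ∃ ρ > 0, e(k) ≥ ρ^k ∀ k ≥ 2)` (`residual_iff_expFloorLaw`) — an exponential floor law with
  UNCONTROLLED constants.  Every notch is NECESSARY (`bdd_of_mm`).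
* §4 (companion file `FarEdgeDescentDefectWorlds`) **SEPARATING WORLDS (PROVED, model profiles stated as
  such).**  The notches are pairwise distinct as profile statements: the LINEAR-HEAD world `E(x) = w·max(2−x, e^{1−x}/2)` (convex, non-increasing, `→ 0`,
  affine of slope `−w` on `[1,3/2]`: `headWorld_affineHead`) obeys `BDD` with `C = 2e²` (`headWorld_bdd`) and
  VIOLATES the anchored law at `m = 3/2` (`headWorld_not_alc`); the STRETCHED world
  `E(x) = w·exp(−2(x−1) + (√x − 1))` (convex, non-increasing for `w ≤ 2/5`) has a geometric floor, i.e. the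
  residual-shape statement holds for it (`stretchWorld_floor`), and VIOLATES every `BDD_C`: its doubling
  defect `exp(2√m − √(2m−1) − 1)` is unbounded (`stretchWorld_not_bdd`, witnesses `m = n²`).  With gen 17's
  exponential world (law with equality) and Gaussian world (contact without a zero): law ⊋ BDD ⊋ residual and
  zero ⊋ contact, each inclusion witnessed.
* §5 (companion file) **WHAT THE LAW OF RECORD OVER-ASKS (PROVED).**  `AnchoredLogConvexity` forbids an
  AFFINE HEAD of the profile: `e(m) = w − t(m−1)` on no interval `[1, 1+2δ]` with `t > 0` (`alc_noAffineHead`) — a GERM condition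
  at the square, foreign to the halving mechanism (the floor of §1 never reads the profile closer to the
  square than `m − 1 ≈ w/2s`); `BDD` tolerates affine heads (§4) and keeps exactly the doubling-scale content
  that the deciding theorems use.

Upshot for the cut: the generic piece can be weakened from the law (`C = 1`) to bounded defect (`∃ C`)
with exactness kept against BOTH special leaves; the weakening is strict and its surplus over the bare
residual is named (§6 restates the cuts BY NAME over the aside `BoundedDoublingDefect` of route rev 10).
Imports only BUILT modules (`FarEdgeDescentExpFloor` ⊇ `Chord`, `LogRate`); no new definitions (the law with
defect `C` is written out as a hypothesis); every statement is about the TRUE exponents or about explicit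
model profiles.
[cite: LottiRomani1983, §1 (p. 173), §2 (p. 174)] [cite: Coppersmith1982] [cite: HuangPan1998, §8]
-/

set_option linter.dupNamespace false

noncomputable section

namespace Summit.MatrixMultiplication.MatrixMultiplication.Theorems.FarEdgeDescentDefectDial

open Literature.Computability.AlgebraicComplexity
open Summit.MatrixMultiplication.MatrixMultiplication.Theses.FarEdgeDescent
open Summit.MatrixMultiplication.MatrixMultiplication.Theorems.FarEdgeDescentChord
open Summit.MatrixMultiplication.MatrixMultiplication.Theorems.FarEdgeDescentExpFloor

/-! ## §0 The abstract engine with defect -/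

/-- **Exponential floor under bounded defect (abstract).** For a profile `E` on `[1,∞)` with the defect-`C`
law `E(m)² ≤ C·w·E(2m−1)` (`m > 1`, `C ≥ 1`, `w > 0`) and the supporting line `E(m) ≥ w − s(m−1)`
(`s ≥ 0`): `E(K) ≥ (w/4C)·exp(−4·log(2C)·(s/w)·(K−1))` for every `K > 1`.  Proof: `orbit_floor` with anchor
value `C·w` at the depth `j` with `2a ≤ 2^j ≤ 4a + 2` (`a = (s/w)(K−1)`), where the line gives
`E(m_j) ≥ w/2`, so `E(K) ≥ C·w·(2C)^{−2^j} ≥ C·w·(2C)^{−(4a+2)}`. -/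
theorem exp_floor_defect {E : ℝ → ℝ} {w s C : ℝ} (hw : 0 < w) (hs : 0 ≤ s) (hC : 1 ≤ C)
    (hlin : ∀ m : ℝ, 1 ≤ m → w - s * (m - 1) ≤ E m)
    (hA : ∀ m : ℝ, 1 < m → E m ^ 2 ≤ C * w * E (2 * m - 1)) {K : ℝ} (hK : 1 < K) :
    w / (4 * C) * Real.exp (-(4 * Real.log (2 * C) * (s / w) * (K - 1))) ≤ E K := by
  set a : ℝ := s / w * (K - 1) with ha
  have ha0 : 0 ≤ a := mul_nonneg (div_nonneg hs hw.le) (by linarith)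
  set L : ℝ := Real.log (2 * C) with hL
  have hC0 : 0 < C := by linarith
  have hCne : C ≠ 0 := hC0.ne'
  have hwne : w ≠ 0 := hw.ne'
  have h2C : (1 : ℝ) ≤ 2 * C := by linarith
  have h2C0 : (0 : ℝ) < 2 * C := by linarith
  have hL0 : 0 ≤ L := Real.log_nonneg h2C
  have hCw : 0 < C * w := mul_pos hC0 hw
  -- choose the depth `j = n + 1` with `2a ≤ 2^j ≤ 4a + 2`
  have hx1 : (1 : ℝ) ≤ max (2 * a) 1 := le_max_right _ _
  obtain ⟨n, hn, hn'⟩ := exists_nat_pow_near hx1 (by norm_num : (1 : ℝ) < 2)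
  have h2a : 2 * a ≤ (2 : ℝ) ^ (n + 1) := (le_max_left _ _).trans hn'.le
  have hjle : (2 : ℝ) ^ (n + 1) ≤ 4 * a + 2 := by
    have hmax : max (2 * a) 1 ≤ 2 * a + 1 := max_le (by linarith) (by linarith)
    rw [pow_succ]
    nlinarith [hn, hmax]
  have h2j : (0 : ℝ) < 2 ^ (n + 1) := pow_pos two_pos _
  have h2jne : (2 : ℝ) ^ (n + 1) ≠ 0 := h2j.ne'
  -- the orbit floor with anchor value `C·w`
  have horbit := orbit_floor (E := E) (w := C * w) hCw hA hK (n + 1)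
  -- the supporting line at depth `j`: `E(m_j) ≥ w/2`
  have hm1 : 1 ≤ 1 + (K - 1) / 2 ^ (n + 1) := by
    have := div_pos (sub_pos.2 hK) h2j
    linarith
  have hline := hlin (1 + (K - 1) / 2 ^ (n + 1)) hm1
  have hsK : s * (K - 1) = w * a := by rw [ha]; field_simp
  have hhalf : w / 2 ≤ E (1 + (K - 1) / 2 ^ (n + 1)) := by
    have e1 : s * (1 + (K - 1) / 2 ^ (n + 1) - 1) = w * a / 2 ^ (n + 1) := by
      rw [← hsK]; ring
    have e2 : w * a / 2 ^ (n + 1) ≤ w / 2 := by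
      rw [div_le_div_iff₀ h2j two_pos]
      nlinarith [h2a, hw]
    linarith [e1, e2, hline]
  -- hence the base of the orbit power is at least `1/(2C)`
  have hbase : 1 / (2 * C) ≤ E (1 + (K - 1) / 2 ^ (n + 1)) / (C * w) := by
    rw [div_le_div_iff₀ h2C0 hCw]
    have := mul_le_mul_of_nonneg_right hhalf h2C0.le
    nlinarith [this, hC0, hw]
  have hb0 : (0 : ℝ) ≤ 1 / (2 * C) := by positivity
  have hpow : (1 / (2 * C)) ^ 2 ^ (n + 1) ≤
      (E (1 + (K - 1) / 2 ^ (n + 1)) / (C * w)) ^ 2 ^ (n + 1) :=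
    pow_le_pow_left₀ hb0 hbase _
  -- `(1/(2C))^(2^j) = exp(−2^j·L) ≥ exp(−(4a+2)·L)`
  have hb : (1 : ℝ) / (2 * C) = Real.exp (-L) := by
    rw [hL, Real.exp_neg, Real.exp_log h2C0, one_div]
  have hbexp : (1 / (2 * C)) ^ 2 ^ (n + 1) = Real.exp (-((2 : ℝ) ^ (n + 1) * L)) := by
    rw [hb, ← Real.exp_nat_mul]
    congr 1
    push_cast
    ring
  have hexp_ge : Real.exp (-((4 * a + 2) * L)) ≤ Real.exp (-((2 : ℝ) ^ (n + 1) * L)) := by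
    rw [Real.exp_le_exp]
    have := mul_le_mul_of_nonneg_right hjle hL0
    linarith
  -- assemble
  have e4 : Real.exp (-(2 * L)) = 1 / (2 * C) ^ 2 := by
    rw [Real.exp_neg, show (2 : ℝ) * L = ((2 : ℕ) : ℝ) * L by norm_num, Real.exp_nat_mul, hL,
      Real.exp_log h2C0, one_div]
  have hsplit : w / (4 * C) * Real.exp (-(4 * L * (s / w) * (K - 1))) =
      C * w * Real.exp (-((4 * a + 2) * L)) := by
    have e3 : -((4 * a + 2) * L) = -(4 * L * (s / w) * (K - 1)) + -(2 * L) := by rw [ha]; ring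
    rw [e3, Real.exp_add, e4]
    field_simp
    ring
  rw [hsplit]
  calc C * w * Real.exp (-((4 * a + 2) * L)) ≤ C * w * Real.exp (-((2 : ℝ) ^ (n + 1) * L)) :=
        mul_le_mul_of_nonneg_left hexp_ge hCw.le
    _ = C * w * (1 / (2 * C)) ^ 2 ^ (n + 1) := by rw [hbexp]
    _ ≤ C * w * (E (1 + (K - 1) / 2 ^ (n + 1)) / (C * w)) ^ 2 ^ (n + 1) :=
        mul_le_mul_of_nonneg_left hpow hCw.le
    _ ≤ E K := horbit

/-! ## §1 The floor under bounded doubling defect, at the true exponents -/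

/-- The defect constant can be RAISED (the right-hand side `C·e(1)·e(2m−1)` is non-decreasing in `C`, both
excesses being `≥ 0`); in particular one may assume `C ≥ 1`. -/
theorem bdd_mono {C C' : ℝ} (hCC' : C ≤ C')
    (hB : ∀ m : ℝ, 1 < m → (omegaRect ℂ 1 m 1 - (m + 1)) ^ 2 ≤
      C * (omegaRect ℂ 1 1 1 - 2) * (omegaRect ℂ 1 (2 * m - 1) 1 - 2 * m)) :
    ∀ m : ℝ, 1 < m → (omegaRect ℂ 1 m 1 - (m + 1)) ^ 2 ≤
      C' * (omegaRect ℂ 1 1 1 - 2) * (omegaRect ℂ 1 (2 * m - 1) 1 - 2 * m) := by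
  intro m hm
  have hprod : 0 ≤ (omegaRect ℂ 1 1 1 - 2) * (omegaRect ℂ 1 (2 * m - 1) 1 - 2 * m) :=
    mul_nonneg excess_one_nonneg (excess_nonneg_two m)
  have hle : C * (omegaRect ℂ 1 1 1 - 2) * (omegaRect ℂ 1 (2 * m - 1) 1 - 2 * m) ≤
      C' * (omegaRect ℂ 1 1 1 - 2) * (omegaRect ℂ 1 (2 * m - 1) 1 - 2 * m) := by
    rw [mul_assoc, mul_assoc]
    exact mul_le_mul_of_nonneg_right hCC' hprod
  exact (hB m hm).trans hle

/-- **EXPONENTIAL FLOOR under defect `C` (PROVED).** `BDD_C ∧ ω > 2 ⟹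
e(K) ≥ ((ω−2)/4C)·exp(−4·log(2C)·((3−ω)/(ω−2))·(K−1))` for every real `K > 1` (`C ≥ 1`). -/
theorem expFloor_of_bdd {C : ℝ} (hC : 1 ≤ C)
    (hB : ∀ m : ℝ, 1 < m → (omegaRect ℂ 1 m 1 - (m + 1)) ^ 2 ≤
      C * (omegaRect ℂ 1 1 1 - 2) * (omegaRect ℂ 1 (2 * m - 1) 1 - 2 * m))
    (hω : 2 < omega ℂ) {K : ℝ} (hK : 1 < K) :
    (omega ℂ - 2) / (4 * C) *
        Real.exp (-(4 * Real.log (2 * C) * ((3 - omega ℂ) / (omega ℂ - 2)) * (K - 1))) ≤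
      omegaRect ℂ 1 K 1 - (K + 1) := by
  have hw : 0 < omega ℂ - 2 := sub_pos.2 hω
  refine exp_floor_defect (E := fun m => omegaRect ℂ 1 m 1 - (m + 1)) hw
    (by linarith [omega_le_three' (K := ℂ)]) hC (fun m hm => anchorLine_le_excess hm)
    (fun m hm => ?_) hK
  have h := hB m hm
  rw [omegaRect_one_one_one] at h
  have e : (2 : ℝ) * m - 1 + 1 = 2 * m := by ring
  show (omegaRect ℂ 1 m 1 - (m + 1)) ^ 2 ≤
    C * (omega ℂ - 2) * (omegaRect ℂ 1 (2 * m - 1) 1 - (2 * m - 1 + 1))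
  rw [e]; exact h

/-- **GEOMETRIC FLOOR under bounded doubling defect (PROVED).** `BDD ∧ ω > 2 ⟹ ∃ ρ > 0, e(k) ≥ ρ^k` at
EVERY integer `k ≥ 1`: `liminf e(k)^{1/k} > 0`.  (Any defect constant; `C < 1` is first raised to `1`.) -/
theorem geometric_floor_of_bdd
    (hB : ∃ C : ℝ, ∀ m : ℝ, 1 < m → (omegaRect ℂ 1 m 1 - (m + 1)) ^ 2 ≤
      C * (omegaRect ℂ 1 1 1 - 2) * (omegaRect ℂ 1 (2 * m - 1) 1 - 2 * m))
    (hω : 2 < omega ℂ) :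
    ∃ ρ : ℝ, 0 < ρ ∧ ∀ k : ℕ, 1 ≤ k → ρ ^ k ≤ omegaRect ℂ 1 k 1 - (k + 1) := by
  obtain ⟨C, hC⟩ := hB
  have hB' := bdd_mono (le_max_left C 1) hC
  have hC1 : 1 ≤ max C 1 := le_max_right _ _
  have hw : 0 < omega ℂ - 2 := sub_pos.2 hω
  have hlog : 0 ≤ Real.log (2 * max C 1) := Real.log_nonneg (by linarith)
  have hfrac : 0 ≤ (3 - omega ℂ) / (omega ℂ - 2) :=
    div_nonneg (by linarith [omega_le_three' (K := ℂ)]) hw.le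
  have hL0 : 0 ≤ 4 * Real.log (2 * max C 1) * ((3 - omega ℂ) / (omega ℂ - 2)) :=
    mul_nonneg (mul_nonneg (by norm_num) hlog) hfrac
  have hc0 : 0 < (omega ℂ - 2) / (4 * max C 1) := div_pos hw (by linarith)
  refine ⟨Real.exp (-(4 * Real.log (2 * max C 1) * ((3 - omega ℂ) / (omega ℂ - 2)))) *
      min 1 ((omega ℂ - 2) / (4 * max C 1)),
    mul_pos (Real.exp_pos _) (lt_min one_pos hc0), fun k hk => ?_⟩
  refine (geom_le_expProfile hc0 hL0 (k := k) hk).trans ?_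
  rcases Nat.lt_or_ge 1 k with hk1 | hk1
  · have hk1' : (1 : ℝ) < k := by exact_mod_cast hk1
    have hfloor := expFloor_of_bdd hC1 hB' hω hk1'
    have e : -(4 * Real.log (2 * max C 1) * ((3 - omega ℂ) / (omega ℂ - 2)) * ((k : ℝ) - 1)) =
        -(4 * Real.log (2 * max C 1) * ((3 - omega ℂ) / (omega ℂ - 2))) * ((k : ℝ) - 1) := by ring
    rw [e] at hfloor
    have e' : -(4 * Real.log (2 * max C 1) * ((3 - omega ℂ) / (omega ℂ - 2)) * ((k : ℝ) - 1)) =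
        -(4 * Real.log (2 * max C 1) * ((3 - omega ℂ) / (omega ℂ - 2))) * ((k : ℝ) - 1) := e
    calc (omega ℂ - 2) / (4 * max C 1) *
          Real.exp (-(4 * Real.log (2 * max C 1) * ((3 - omega ℂ) / (omega ℂ - 2)) * ((k : ℝ) - 1)))
        = (omega ℂ - 2) / (4 * max C 1) *
          Real.exp (-(4 * Real.log (2 * max C 1) * ((3 - omega ℂ) / (omega ℂ - 2))) * ((k : ℝ) - 1)) := by
          rw [e']
      _ ≤ omegaRect ℂ 1 k 1 - (k + 1) := hfloor
  · have hk_eq : k = 1 := le_antisymm hk1 hk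
    subst hk_eq
    push_cast
    rw [sub_self, mul_zero, neg_zero, Real.exp_zero, mul_one, omegaRect_one_one_one]
    have h4 : (1 : ℝ) ≤ 4 * max C 1 := by linarith
    have := div_le_self hw.le h4
    linarith

/-! ## §2 Two exact cuts with the weaker generic leaf -/

/-- **DECIDING THEOREM, contact form (PROVED).** `SuperExpContact → BDD → ω(ℂ) = 2`: if `ω > 2` the geometric
floor of §1 gives `ρ^k ≤ e(k)` for every `k`, against superexponential contact at that `ρ`. -/
theorem closes_bddSec (h₁ : SuperExpContact)
    (hB : ∃ C : ℝ, ∀ m : ℝ, 1 < m → (omegaRect ℂ 1 m 1 - (m + 1)) ^ 2 ≤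
      C * (omegaRect ℂ 1 1 1 - 2) * (omegaRect ℂ 1 (2 * m - 1) 1 - 2 * m)) :
    _root_.MatrixMultiplication := by
  rw [_root_.MatrixMultiplication_iff]
  refine le_antisymm ?_ (omega_two_le (K := ℂ))
  by_contra hω
  rw [not_le] at hω
  obtain ⟨ρ, hρ, hfloor⟩ := geometric_floor_of_bdd hB hω
  obtain ⟨k, hk, hek⟩ := h₁ ρ hρ
  have := hfloor k (by omega)
  linarith

/-- **DECIDING THEOREM, zero form (PROVED).** `FiniteSaturation → BDD → ω(ℂ) = 2` — the node of record with
its generic leaf weakened from the law (`C = 1`) to bounded defect (`∃ C`).  (A far zero is superexponential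
contact; equivalently, zero-propagation `e(2m−1) = 0 ⟹ e(m)² ≤ C·w·0` works for every `C`.) -/
theorem closes_bddFs (h₁ : FiniteSaturation)
    (hB : ∃ C : ℝ, ∀ m : ℝ, 1 < m → (omegaRect ℂ 1 m 1 - (m + 1)) ^ 2 ≤
      C * (omegaRect ℂ 1 1 1 - 2) * (omegaRect ℂ 1 (2 * m - 1) 1 - 2 * m)) :
    _root_.MatrixMultiplication :=
  closes_bddSec (superExpContact_of_finiteSaturation h₁) hB

/-- The law is the first notch of the dial: `AnchoredLogConvexity ⟹ BDD` (`C = 1`). -/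
theorem bdd_of_alc (h : AnchoredLogConvexity) :
    ∃ C : ℝ, ∀ m : ℝ, 1 < m → (omegaRect ℂ 1 m 1 - (m + 1)) ^ 2 ≤
      C * (omegaRect ℂ 1 1 1 - 2) * (omegaRect ℂ 1 (2 * m - 1) 1 - 2 * m) :=
  ⟨1, fun m hm => by rw [one_mul]; exact h m hm⟩

/-- Necessity: `ω = 2 → BDD` (tag NEC). -/
theorem bdd_of_mm (h : _root_.MatrixMultiplication) :
    ∃ C : ℝ, ∀ m : ℝ, 1 < m → (omegaRect ℂ 1 m 1 - (m + 1)) ^ 2 ≤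
      C * (omegaRect ℂ 1 1 1 - 2) * (omegaRect ℂ 1 (2 * m - 1) 1 - 2 * m) :=
  bdd_of_alc (anchoredLogConvexity_of_mm h)

/-- **Cut B″ is exact**: `ω(ℂ) = 2 ⟺ SuperExpContact ∧ BDD` — BOTH leaves strictly weaker than the node of
record's (special: zero → contact, gen 17; generic: law → bounded defect, companion §4). -/
theorem node_bddSec_iff : _root_.MatrixMultiplication ↔
    (SuperExpContact ∧ ∃ C : ℝ, ∀ m : ℝ, 1 < m → (omegaRect ℂ 1 m 1 - (m + 1)) ^ 2 ≤
      C * (omegaRect ℂ 1 1 1 - 2) * (omegaRect ℂ 1 (2 * m - 1) 1 - 2 * m)) :=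
  ⟨fun h => ⟨superExpContact_of_mm h, bdd_of_mm h⟩, fun h => closes_bddSec h.1 h.2⟩

/-- **Cut A″ is exact**: `ω(ℂ) = 2 ⟺ FiniteSaturation ∧ BDD` — the node of record with only the generic leaf
weakened. -/
theorem node_bddFs_iff : _root_.MatrixMultiplication ↔
    (FiniteSaturation ∧ ∃ C : ℝ, ∀ m : ℝ, 1 < m → (omegaRect ℂ 1 m 1 - (m + 1)) ^ 2 ≤
      C * (omegaRect ℂ 1 1 1 - 2) * (omegaRect ℂ 1 (2 * m - 1) 1 - 2 * m)) :=
  ⟨fun h => ⟨finiteSaturation_of_mm h, bdd_of_mm h⟩, fun h => closes_bddFs h.1 h.2⟩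

/-! ## §3 The dial: law ⟹ bounded defect ⟹ bare residual -/

/-- **The bare residual of the special leaf is an exponential-floor law with uncontrolled constants**:
`(SuperExpContact → ω = 2) ⟺ (ω > 2 → ∃ ρ > 0, ∀ k ≥ 2, e(k) ≥ ρ^k)`.  (So `BDD` = "the floor, WITH its
constants tied to `ω` by the doubling law"; the residual = "some floor".) -/
theorem residual_iff_expFloorLaw :
    (SuperExpContact → _root_.MatrixMultiplication) ↔
      (2 < omega ℂ → ∃ ρ : ℝ, 0 < ρ ∧ ∀ k : ℕ, 2 ≤ k → ρ ^ k ≤ omegaRect ℂ 1 k 1 - (k + 1)) := by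
  constructor
  · intro h hω
    by_contra hne
    push Not at hne
    have hS : SuperExpContact := fun ρ hρ => hne ρ hρ
    have hmm := h hS
    rw [_root_.MatrixMultiplication_iff] at hmm
    linarith
  · intro h hS
    rw [_root_.MatrixMultiplication_iff]
    refine le_antisymm ?_ (omega_two_le (K := ℂ))
    by_contra hω
    rw [not_le] at hω
    obtain ⟨ρ, hρ, hfloor⟩ := h hω
    obtain ⟨k, hk, hek⟩ := hS ρ hρ
    have := hfloor k hk
    linarith

/-- **The dial (PROVED chain).** `RealLogConvexity ⟹ AnchoredLogConvexity ⟹ BDD ⟹ (SuperExpContact → ω = 2)`: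
real three-term law ⟹ its anchored slice (gen 17) ⟹ bounded defect (`C = 1`) ⟹ the bare residual (§2).
Each implication is STRICT as a profile statement (companion file §4 and gen 17 §3). -/
theorem dial_chain :
    (RealLogConvexity → AnchoredLogConvexity) ∧
    (AnchoredLogConvexity → ∃ C : ℝ, ∀ m : ℝ, 1 < m → (omegaRect ℂ 1 m 1 - (m + 1)) ^ 2 ≤
      C * (omegaRect ℂ 1 1 1 - 2) * (omegaRect ℂ 1 (2 * m - 1) 1 - 2 * m)) ∧
    ((∃ C : ℝ, ∀ m : ℝ, 1 < m → (omegaRect ℂ 1 m 1 - (m + 1)) ^ 2 ≤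
      C * (omegaRect ℂ 1 1 1 - 2) * (omegaRect ℂ 1 (2 * m - 1) 1 - 2 * m)) →
      (SuperExpContact → _root_.MatrixMultiplication)) :=
  ⟨anchored_of_realLogConvexity, bdd_of_alc, fun hB hS => closes_bddSec hS hB⟩

/-! ## §6 By name: the aside `BoundedDoublingDefect` (stmt-MatrixMultiplication-26556, route rev 10) -/

/-- The aside of record IS the bounded-defect law written out above (definitional unfolding). -/
theorem boundedDoublingDefect_iff : BoundedDoublingDefect ↔
    ∃ C : ℝ, ∀ m : ℝ, 1 < m → (omegaRect ℂ 1 m 1 - (m + 1)) ^ 2 ≤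
      C * (omegaRect ℂ 1 1 1 - 2) * (omegaRect ℂ 1 (2 * m - 1) 1 - 2 * m) :=
  Iff.rfl

/-- NEC by name: `ω = 2 → BoundedDoublingDefect`. -/
theorem boundedDoublingDefect_of_mm (h : _root_.MatrixMultiplication) : BoundedDoublingDefect :=
  bdd_of_mm h

/-- First notch by name: the crux `AnchoredLogConvexity` (28900) implies the aside (26556). -/
theorem boundedDoublingDefect_of_alc (h : AnchoredLogConvexity) : BoundedDoublingDefect :=
  bdd_of_alc h

/-- **Cut A″ by name (PROVED):** `FiniteSaturation → BoundedDoublingDefect → ω(ℂ) = 2` — the certified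
one-command re-glue of the route with only the generic leaf weakened (gen 18 `glue18a.lean`). -/
theorem closes_cutA'' (h₁ : FiniteSaturation) (h₂ : BoundedDoublingDefect) : _root_.MatrixMultiplication :=
  closes_bddFs h₁ h₂

/-- **Cut B″ by name (PROVED):** `SuperExpContact → BoundedDoublingDefect → ω(ℂ) = 2` — both leaves of the
node of record weakened (special: gen 17; generic: gen 18). -/
theorem closes_cutB'' (h₁ : SuperExpContact) (h₂ : BoundedDoublingDefect) : _root_.MatrixMultiplication :=
  closes_bddSec h₁ h₂

/-- Cut A″ is exact, by name: `ω(ℂ) = 2 ⟺ FiniteSaturation ∧ BoundedDoublingDefect`. -/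
theorem node_cutA''_iff : _root_.MatrixMultiplication ↔ FiniteSaturation ∧ BoundedDoublingDefect :=
  node_bddFs_iff

/-- Cut B″ is exact, by name: `ω(ℂ) = 2 ⟺ SuperExpContact ∧ BoundedDoublingDefect`. -/
theorem node_cutB''_iff : _root_.MatrixMultiplication ↔ SuperExpContact ∧ BoundedDoublingDefect :=
  node_bddSec_iff

/-- The dial by name: `RealLogConvexity (28902) ⟹ AnchoredLogConvexity (28900) ⟹ BoundedDoublingDefect (26556)
⟹ (SuperExpContact (28901) → ω = 2)`. -/
theorem dial_chain_byName :
    (RealLogConvexity → AnchoredLogConvexity) ∧ (AnchoredLogConvexity → BoundedDoublingDefect) ∧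
      (BoundedDoublingDefect → SuperExpContact → _root_.MatrixMultiplication) :=
  ⟨anchored_of_realLogConvexity, bdd_of_alc, fun hB hS => closes_bddSec hS hB⟩

end Summit.MatrixMultiplication.MatrixMultiplication.Theorems.FarEdgeDescentDefectDial
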